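/-
Copyright (c) 2026. All rights reserved.
Released under Apache 2.0 license as described in the file LICENSE.
Authors: abc-iut cell, seat abc-iut-w5-d053 (gen 4) over abc-iut-L4-t5 (gen 6/7)'s assembly — the closer of
[AbsTopIII] Cor 3.7 (v), final sentence (successor statement).
-/
import Literature.AnabelianGeometry.AbsoluteAnabelian.AbsTopIII.BiAnabelianCompatibilityTeleDeltaShiftCompatible
import Literature.AnabelianGeometry.AbsoluteAnabelian.AbsTopIII.BiAnabelianLogGlueAffine
import HarnessLib

/-!
# [AbsTopIII] Cor 3.7 (v), final sentence — `ShiftCompatStmt′ θ` CLOSED under `ι` over Galois, and at the affine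
# sub-model with no displayed hypothesis

S. Mochizuki, *Topics in absolute anabelian geometry III* [MochizukiAbsTopIII2015] (kurims manuscript
`paper:url-5493eb38cbb7`), Cor 3.7 (v) p. 88: "the self-equivalences in these nexus-classes are compatible with
`ℋ_δ` [cf. (ii)], as well as with the families of homotopies that constitute the cores, telecore, and observable of
(i), (ii), (iii)" — statement of record abc-iut-L4-t5's successor `ShiftCompatStmt′ θ` (`BiAnabelianCompatibilityShift`;
the gen-5 joint-family typing is refuted at the model, F-L4t5g6-1).

PROOF-ONLY one-liners: abc-iut-L4-t5 gen 7's `shiftCompatStmt'_of_iotaOverGal_of_shiftInvariant` (p470526: the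
canonical shadow family realising `𝔗_δ`, `ℋ_δ` is `Φ_m`-compatible unconditionally) at its one remaining named input,
the `Φ_m`-invariance of the glued family `K₂ = glueLogFamily hT hL` — which is `compatibleWith_shiftEquiv_glueLogFamily`
(`BiAnabelianLogGlueShift.lean`, p469403).  Hence `ShiftCompatStmt′ θ` under the displayed (H×), (Hlog) for every
setting and lift datum, and at the affine sub-model `𝒳_{P₀}` (θ^bi := `biAnabelianLiftOfFull`, (H×)/(Hlog) the
restricted model identities) with NO displayed hypothesis.  HONEST FRAMING: model-level ≠ node-level; nothing here
bears on [IUTchIII] Cor. 3.12; typed ≠ proved elsewhere.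
-/

set_option autoImplicit false

namespace Literature.AnabelianGeometry.AbsoluteAnabelian.AbsTopIII

open CategoryTheory

universe u

namespace BiAnabelianSetting

variable {X E N : Type u} [Category.{u} X] [Category.{u} E] [Category.{u} N]
  (𝔖 : BiAnabelianSetting X E N) (θ : FiberSquare.BiAnabelianLift 𝔖.gal)
  (hT : ∀ y : X, 𝔖.spaceGal.map (𝔖.iotaTimes.app y) = 𝔖.lamTimesGal.hom.app y ≫ 𝔖.lamTimesPfGal.inv.app y)
  (hL : ∀ A : X, 𝔖.spaceGal.map (𝔖.iotaLog.app A) =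
    𝔖.lamTimesGal.hom.app (𝔖.log.obj A) ≫ 𝔖.logGal.hom.app A ≫ 𝔖.lamTimesPfGal.inv.app A)

include θ hT hL

/-- **[AbsTopIII] Cor 3.7 (v), final sentence (`ShiftCompatStmt′ θ`) — CLOSED under (H×), (Hlog)**: the `ℤ`-action
`Φ = shiftEquiv` of (v) is compatible (Def 3.5 (v)) with a family realising the cores, `𝔖†_log` and the telecore `𝒥`
(the glued family `K₂`) AND with a family realising `𝔗_δ` with `ℋ_δ` (the canonical shadow family).
[cite: MochizukiAbsTopIII2015, Cor 3.7 (v) p.88] -/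
theorem shiftCompatStmt'_of_iotaOverGal :
    Literature.AnabelianGeometry.AbsoluteAnabelian.AbsTopIII.BiAnabelianSetting.ShiftCompatStmt' 𝔖 θ :=
  𝔖.shiftCompatStmt'_of_iotaOverGal_of_shiftInvariant θ hT hL (𝔖.compatibleWith_shiftEquiv_glueLogFamily hT hL)

end BiAnabelianSetting

namespace TFModel

variable (p : ℕ) [Fact p.Prime]

/-- **[AbsTopIII] Cor 3.7 (v), final sentence (`ShiftCompatStmt′`) at the affine sub-model `𝒳_{P₀}`**, with
`θ^bi := biAnabelianLiftOfFull` (non-vacuous) and NO displayed hypothesis.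
[cite: MochizukiAbsTopIII2015, Cor 3.7 (v) p.88] -/
theorem shiftCompatStmt'_isAffineModel :
    ((modelSetting p).restrict (IsAffineModel (p := p)) fun _ h => h).ShiftCompatStmt'
      (biAnabelianLiftOfFull p _ full_galP_isAffineModel) :=
  ((modelSetting p).restrict (IsAffineModel (p := p)) fun _ h => h).shiftCompatStmt'_of_iotaOverGal
    (biAnabelianLiftOfFull p _ full_galP_isAffineModel)
    ((modelSetting p).restrict_iotaTimes_overGal _ _ (modelSetting_iotaTimes_overGal p))
    ((modelSetting p).restrict_iotaLog_overGal _ _ (modelSetting_iotaLog_overGal p))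

/-- The same for every sub-model `𝒳_P` at which Prop 3.2 (iv) surjectivity holds (`(P.ι ⋙ gal).Full`, the source
of `θ^bi`). [cite: MochizukiAbsTopIII2015, Cor 3.7 (v) p.88] -/
theorem shiftCompatStmt'_restrict_of_full (P : ObjectProperty (TFModel p)) (hfull : (P.ι ⋙ TFModel.gal p).Full) :
    ((modelSetting p).restrict P fun _ h => h).ShiftCompatStmt' (biAnabelianLiftOfFull p P hfull) :=
  ((modelSetting p).restrict P fun _ h => h).shiftCompatStmt'_of_iotaOverGal (biAnabelianLiftOfFull p P hfull)
    ((modelSetting p).restrict_iotaTimes_overGal _ _ (modelSetting_iotaTimes_overGal p))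
    ((modelSetting p).restrict_iotaLog_overGal _ _ (modelSetting_iotaLog_overGal p))

end TFModel

end Literature.AnabelianGeometry.AbsoluteAnabelian.AbsTopIII
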